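import Mathlib
import Literature.NumberTheory.PAdicHodge.UnramifiedCompletionToPadicComplex
import Literature.NumberTheory.PAdicHodge.UnramifiedWittVectors
import HarnessLib

/-!
# Door5SupplyO — crux `TwoVariableEulerSystemDivisibility` (stmt-BirchSwinnertonDyer-20728), door 5, (G0)(i) (i-a):
# the map `ι_W : W(𝔽̄_p) → 𝒪_{ℂ_p}` ASSEMBLED from the tree, and `HasUnramifiedModel p J G ⇐ HasWittModel p G`

Crux workfile (seat `bsd-idea-14` g24, lens `complete`; companion of `Door5Supply.lean` v1.5 §7.4–§7.5 and `Door5.md` §4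
item 0). `Door5Supply.lean` v1.5 typed door 5's one owed CONSTRUCTION input as
`HasUnramifiedModel p J G` («`G ∈ 𝒪_{ℂ_p}⟦T₁⟧⟦T₂⟧` has a model over some absolutely unramified complete DVR `𝒪` of
characteristic `0` mapping to `𝒪_{ℂ_p}`») and proved `hasUnramifiedModel_witt`: over `𝒪 = W(k)` (`k` any perfect field of
characteristic `p`) ANY ring map `ι : W(k) → 𝒪_{ℂ_p}` and any `ι`-model of `G` inhabit it. What it left owed under (G0)(i) was
split in `Door5.md` §4 item 0 into

* (i-a) the GLUE: an actual ring map `ι_W : W(𝔽̄_p) → 𝒪_{ℂ_p} = PadicComplexInt p` built from the tree's p-adic Hodge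
  theory files — `wittToCompletion ℚ_[p] p : 𝕎 k̄ →+* 𝒪̂_{ℚ_p^nr}` (`UnramifiedWittVectors`, Serre II §5 Thm 4) and
  `maxUnramifiedCompletion.toPadicComplexInt p : 𝒪̂_{ℚ_p^nr} →+* unitBall ℂ_[p]` (`UnramifiedCompletionToPadicComplex`) —
  which needs (α) the identification `unitBall ℂ_[p] ≃+* PadicComplexInt p` of the tree's `{‖x‖ ≤ 1}` with Mathlib's
  `{v x ≤ 1}` and (β) the instance discharges of `wittToCompletion` at `F = ℚ_[p]`;
* (i-b) the ARITHMETIC input: the frame's `G` (Katz two-variable measure × the frame's factors) HAS a `W(𝔽̄_p)`-model.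

THIS FILE DOES (i-a) COMPLETELY and types (i-b) as ONE named Prop:

* §1 (α) `norm_eq_coe_valuation : ‖x‖ = v x` on `ℂ_[p]` (Mathlib `PadicComplex.norm_eq_norm` + `Valuation.embedding_restrict`),
  `mem_unitBall_iff_mem_padicComplexInt`, **`unitBallEquivPadicComplexInt p : unitBall ℂ_[p] ≃+* PadicComplexInt p`** (the
  identity on underlying elements: `coe_unitBallEquivPadicComplexInt`).
* §2 (β) at `F = ℚ_[p]`: `IsNonarchimedeanLocalField ℚ_[p]` (tree `Padic.isNonarchimedeanLocalField_holds`), `p ∉ 𝒪̂ˣ`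
  (`not_isUnit_natCast_completion` ∘ Mathlib `Padic.valuation_p_lt_one`), `CharP k̄ p`, `PerfectRing k̄ p`, `𝒪̂` `p`-adically
  complete (`isAdicComplete_span_natCast_completion`) — all as LOCAL instances (no global instance is declared by this file's
  importers: Cruxes files are never imported) — where **`ResidueFieldBar p := ResidueField 𝒪̂_{ℚ_p^nr} = 𝔽̄_p`** (algebraically
  closed: tree instance `isAlgClosed_residueField_completion`).
* §3 **`iotaW p : 𝕎 (ResidueFieldBar p) →+* PadicComplexInt p`** `:= (α) ∘ toPadicComplexInt ∘ wittToCompletion ℚ_[p] p`, its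
  unfolding into `ℂ_[p]` (`coe_iotaW`), `‖ι_W x‖ ≤ 1`, and **`iotaW_injective`** (a ring map out of the DVR `W(k̄)` into a
  characteristic-`0` domain has zero kernel: `x = p^m·u`), so a `W(𝔽̄_p)`-model along `ι_W` is UNIQUE (`wittModel_unique`).
* §4 `HasUnramifiedModel p J G` restated TOKEN-FOR-TOKEN from `Door5Supply.lean` v1.5 (l. 2458; Cruxes files are not importable,
  the two `def`s have identical bodies), **`HasWittModel p G := ∃ GW, (GW.map (map ι_W)) = G`** = (i-b) typed, its coefficientwise
  form `hasWittModel_iff_forall_coeff_mem_range` (every coefficient of `G` lies in `ι_W(W(𝔽̄_p)) ⊆ 𝒪_{ℂ_p}` — the form in which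
  Katz's theorem «the measure is `W(𝔽̄_p)`-valued» is quoted), and the glue theorem
  **`hasUnramifiedModel_of_hasWittModel : HasWittModel p G → HasUnramifiedModel p J G`** for EVERY `J` (the conjunct
  `ι_W ∘ (ℤ_p → W) = J` is automatic: ring maps `ℤ_p → 𝒪_{ℂ_p}` are unique, `ringHom_padicInt_ext'`).

NET EFFECT ON THE OWED LIST (`Door5.md` §4 item 0): (G0)(i) (i-a) is DONE; door 5's coefficient-model input is now exactly the
arithmetic statement (i-b) `HasWittModel p G` for the frame's `G` [Katz 1978 §5.3; Hida–Tilouine 1993 Thm 1.1: the Katz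
two-variable `p`-adic `L`-function of the imaginary quadratic `K` (p split) is a measure with values in `W = W(𝔽̄_p)`], plus the
`W`-integrality of the frame's remaining factors — a Literature typer's item, not derivable from the frame predicates
`IsKatzMeasure₂` / `IsGreenbergLFunctionAnyRoot₂` (they constrain interpolation VALUES only; `Door5.md` §2).

HONEST FRAMING: plumbing over Mathlib and two tree files; rc 0, no `sorry`, no new axioms; nothing here is arithmetic. It does not
prove 20728, its parent K1″, or any summit statement; BSD is not proved by this file or this seat.

## References
* [SerreLocalFields1979] J.-P. Serre, *Local Fields*, GTM 67, Ch. II §5 Thm 4 (`𝒪̂_{ℚ_p^nr} = W(𝔽̄_p)`), §6.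
* [Katz1978] N. M. Katz, *p-adic L-functions for CM fields*, Invent. Math. 49 (1978), §5.3 (the measure is `W`-valued).
* [HidaTilouine1993] H. Hida, J. Tilouine, *Anticyclotomic Katz p-adic L-functions and congruence modules*, Ann. Sci. ÉNS 26
  (1993), Thm 1.1.
* [FontaineOuyang2022] J.-M. Fontaine, Y. Ouyang, *Theory of p-adic Galois representations*, §3.1.
-/

set_option autoImplicit false
set_option linter.dupNamespace false

noncomputable section

open scoped NNReal
open IsLocalRing PowerSeries

namespace Summit.BirchSwinnertonDyer.BirchSwinnertonDyer.Cruxes.TwoVariableEulerSystemDivisibility.Door5SupplyO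

open Literature.NumberTheory.PAdicHodge
open Literature.NumberTheory.GaloisRepresentations
open Literature.NumberTheory.GaloisRepresentations.IsNonarchimedeanLocalField
open Literature.NumberTheory.GaloisRepresentations.LubinTate

/-! ## §1 (α) `unitBall ℂ_[p] = PadicComplexInt p` -/

section Alpha

variable (p : ℕ) [Fact p.Prime]

/-- On `ℂ_[p]` the norm IS the (`ℝ≥0`-valued) valuation: `‖x‖ = v x`. (Mathlib: `PadicComplex.norm_eq_norm`, the rank-one
structure of `PadicComplex.valued` is the tautological `embedding`, `Valuation.embedding_restrict`.) [folklore] -/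
theorem norm_eq_coe_valuation (x : ℂ_[p]) : ‖x‖ = ((Valued.v x : ℝ≥0) : ℝ) := by
  rw [PadicComplex.norm_eq_norm p x, Valuation.norm_def, PadicComplex.RankOne.hom_eq_embedding,
    Valuation.embedding_restrict]

/-- `‖x‖ ≤ 1 ↔ v x ≤ 1` on `ℂ_[p]`. [folklore] -/
theorem norm_le_one_iff_valuation_le_one (x : ℂ_[p]) : ‖x‖ ≤ 1 ↔ Valued.v x ≤ 1 := by
  rw [norm_eq_coe_valuation p x, ← NNReal.coe_one, NNReal.coe_le_coe]

/-- The tree's unit ball `{‖x‖ ≤ 1}` of `ℂ_[p]` and Mathlib's `PadicComplexInt p = {v x ≤ 1}` have the same elements.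
[folklore] -/
theorem mem_unitBall_iff_mem_padicComplexInt (x : ℂ_[p]) : x ∈ unitBall ℂ_[p] ↔ x ∈ PadicComplexInt p := by
  rw [mem_unitBall_iff, norm_le_one_iff_valuation_le_one, PadicComplexInt, Valuation.mem_valuationSubring_iff]

/-- **(α) `unitBall ℂ_[p] ≃+* PadicComplexInt p`**, the identity on underlying elements of `ℂ_[p]`. [folklore] -/
def unitBallEquivPadicComplexInt : unitBall ℂ_[p] ≃+* PadicComplexInt p where
  toFun x := ⟨(x : ℂ_[p]), (mem_unitBall_iff_mem_padicComplexInt p _).mp x.2⟩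
  invFun y := ⟨(y : ℂ_[p]), (mem_unitBall_iff_mem_padicComplexInt p _).mpr y.2⟩
  left_inv _ := rfl
  right_inv _ := rfl
  map_mul' _ _ := rfl
  map_add' _ _ := rfl

@[simp]
theorem coe_unitBallEquivPadicComplexInt (x : unitBall ℂ_[p]) :
    ((unitBallEquivPadicComplexInt p x : PadicComplexInt p) : ℂ_[p]) = (x : ℂ_[p]) := rfl

@[simp]
theorem coe_unitBallEquivPadicComplexInt_symm (y : PadicComplexInt p) :
    (((unitBallEquivPadicComplexInt p).symm y : unitBall ℂ_[p]) : ℂ_[p]) = (y : ℂ_[p]) := rfl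

/-- Norm form of membership in `PadicComplexInt p`. [folklore] -/
theorem norm_coe_padicComplexInt_le_one (y : PadicComplexInt p) : ‖(y : ℂ_[p])‖ ≤ 1 :=
  (mem_unitBall_iff ℂ_[p]).mp ((mem_unitBall_iff_mem_padicComplexInt p _).mpr y.2)

end Alpha

/-! ## §2 (β) the instance discharges at `F = ℚ_[p]` (local instances) and `k̄ = 𝔽̄_p` -/

section Beta

variable (p : ℕ) [Fact p.Prime]

/-- `ℚ_[p]` is a non-archimedean local field (tree `Padic.isNonarchimedeanLocalField_holds`; a `Prop`-valued Mathlib class,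
so this local instance is proof-irrelevantly the one the tree files bake into their statements). [folklore] -/
theorem isNonarchimedeanLocalField_padic : IsNonarchimedeanLocalField ℚ_[p] :=
  Padic.isNonarchimedeanLocalField_holds p

attribute [local instance] isNonarchimedeanLocalField_padic

/-- **`k̄ = 𝔽̄_p`**, realised as the residue field of `𝒪̂_{ℚ_p^nr} = maxUnramifiedCompletion ℚ_[p]` (algebraically closed by the
tree instance `isAlgClosed_residueField_completion`). [cite: SerreLocalFields1979, Ch. II §5] -/
abbrev ResidueFieldBar : Type := ResidueField (maxUnramifiedCompletion ℚ_[p])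

/-- `v_{ℚ_p}(p) < 1` for the `ValuativeRel` valuation (Mathlib `Padic.valuation_p_lt_one`). [folklore] -/
theorem valuation_padic_natCast_lt_one : ValuativeRel.valuation ℚ_[p] (p : ℚ_[p]) < 1 :=
  _root_.Padic.valuation_p_lt_one (ValuativeRel.valuation ℚ_[p])

/-- `p` is not a unit of `𝒪̂_{ℚ_p^nr}` (tree `not_isUnit_natCast_completion`). [folklore] -/
theorem fact_not_isUnit_natCast_completion_padic :
    Fact (¬ IsUnit ((p : ℕ) : maxUnramifiedCompletion ℚ_[p])) :=
  ⟨not_isUnit_natCast_completion (valuation_padic_natCast_lt_one p)⟩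

attribute [local instance] fact_not_isUnit_natCast_completion_padic

/-- `k̄` has characteristic `p` (tree `charP_residueField_completion`). [folklore] -/
theorem charP_residueFieldBar : CharP (ResidueFieldBar p) p :=
  charP_residueField_completion

attribute [local instance] charP_residueFieldBar

/-- `k̄` is perfect (tree `perfectRing_residueField_completion`; it is algebraically closed). [folklore] -/
theorem perfectRing_residueFieldBar : PerfectRing (ResidueFieldBar p) p :=
  perfectRing_residueField_completion

attribute [local instance] perfectRing_residueFieldBar

/-- `k̄` is algebraically closed (tree instance, recorded). [cite: SerreLocalFields1979, Ch. IV §4] -/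
theorem isAlgClosed_residueFieldBar : IsAlgClosed (ResidueFieldBar p) := inferInstance

/-- `𝒪̂_{ℚ_p^nr}` is `p`-adically complete and separated (tree `isAdicComplete_span_natCast_completion`). [folklore] -/
theorem isAdicComplete_span_natCast_completion_padic :
    IsAdicComplete (Ideal.span {((p : ℕ) : maxUnramifiedCompletion ℚ_[p])}) (maxUnramifiedCompletion ℚ_[p]) :=
  isAdicComplete_span_natCast_completion (valuation_padic_natCast_lt_one p) (Nat.Prime.ne_zero Fact.out)

attribute [local instance] isAdicComplete_span_natCast_completion_padic

/-! ## §3 `ι_W : W(𝔽̄_p) → 𝒪_{ℂ_p}` -/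

/-- **`ι_W : W(𝔽̄_p) →+* 𝒪_{ℂ_p}`** `= (unitBall ℂ_[p] ≃ PadicComplexInt p) ∘ (𝒪̂_{ℚ_p^nr} → unitBall ℂ_[p]) ∘ (W(k̄) → 𝒪̂_{ℚ_p^nr})`:
Serre's embedding `W(k̄) ⊆ 𝒪̂_{ℚ_p^nr}` (tree `wittToCompletion ℚ_[p] p`, Fontaine's `θ`) followed by the `p`-adically continuous
extension of `𝒪_{ℚ_p^nr} ⊆ ℚ̄_p ⊆ ℂ_p` (tree `maxUnramifiedCompletion.toPadicComplexInt p`) and §1 (α).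
[cite: SerreLocalFields1979, Ch. II §5 Thm 4] [cite: FontaineOuyang2022, §3.1] -/
def iotaW : WittVector p (ResidueFieldBar p) →+* PadicComplexInt p :=
  (unitBallEquivPadicComplexInt p).toRingHom.comp
    ((maxUnramifiedCompletion.toPadicComplexInt p).comp (wittToCompletion ℚ_[p] p))

/-- Unfolding of `ι_W` into `ℂ_[p]`: `ι_W x = toPadicComplex (wittToCompletion x)`. [folklore] -/
theorem coe_iotaW (x : WittVector p (ResidueFieldBar p)) :
    ((iotaW p x : PadicComplexInt p) : ℂ_[p]) = maxUnramifiedCompletion.toPadicComplex p (wittToCompletion ℚ_[p] p x) := rfl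

/-- `‖ι_W x‖ ≤ 1`. [folklore] -/
theorem norm_coe_iotaW_le_one (x : WittVector p (ResidueFieldBar p)) : ‖((iotaW p x : PadicComplexInt p) : ℂ_[p])‖ ≤ 1 :=
  norm_coe_padicComplexInt_le_one p _

/-- `ι_W` on Teichmüller representatives reduces correctly: `res_{𝒪̂}(wittToCompletion [y]) = y` (tree
`residue_wittToCompletion`), recorded in the form `res (wittToCompletion x) = x₀`. [cite: SerreLocalFields1979, Ch. II §5 Thm 4] -/
theorem residue_wittToCompletion_padic (x : WittVector p (ResidueFieldBar p)) :
    IsLocalRing.residue (maxUnramifiedCompletion ℚ_[p]) (wittToCompletion ℚ_[p] p x) = x.coeff 0 :=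
  residue_wittToCompletion x

/-- `𝒪_{ℂ_p}` has characteristic `0`. [folklore] -/
theorem charZero_padicComplexInt : CharZero (PadicComplexInt p) := inferInstance

/-- **`ι_W` is injective**: a ring map out of `W(k̄)` (every non-zero element is `p^m · u`, `u` a unit — Mathlib
`WittVector.exists_eq_pow_p_mul'`) into a ring of characteristic `0` without zero divisors kills nothing. [folklore] -/
theorem iotaW_injective : Function.Injective (iotaW p) := by
  rw [injective_iff_map_eq_zero]
  intro x hx
  by_contra hne
  obtain ⟨m, u, rfl⟩ := WittVector.exists_eq_pow_p_mul' x hne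
  rw [map_mul, map_pow, map_natCast] at hx
  have hu : IsUnit (iotaW p (u : WittVector p (ResidueFieldBar p))) := (Units.isUnit u).map _
  have hpm : ((p : PadicComplexInt p) ^ m) = 0 := hu.mul_left_eq_zero.mp hx
  haveI := charZero_padicComplexInt p
  exact (pow_ne_zero m (Nat.cast_ne_zero.mpr (Nat.Prime.ne_zero Fact.out))) hpm

/-- `PowerSeries.map (PowerSeries.map ι_W)` is injective: a `W(𝔽̄_p)`-model along `ι_W` is unique. [folklore] -/
theorem wittModel_unique {GW GW' : PowerSeries (PowerSeries (WittVector p (ResidueFieldBar p)))}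
    (h : PowerSeries.map (PowerSeries.map (iotaW p)) GW = PowerSeries.map (PowerSeries.map (iotaW p)) GW') : GW = GW' :=
  PowerSeries.map_injective _ (PowerSeries.map_injective _ (iotaW_injective p)) h

/-! ## §4 `HasUnramifiedModel` (restated token-for-token), `HasWittModel` = (i-b) typed, and the glue -/

/-- **Restated TOKEN-FOR-TOKEN from `Door5Supply.lean` v1.5 (l. 2458)** — (G0)(i) as one typed owed input: `G` has a model over
some absolutely unramified complete DVR of characteristic `0` mapping to `𝒪_{ℂ_p}` over `J`. (Cruxes files are not importable;
the two `def`s have identical bodies, so every consumer of `Door5Supply.HasUnramifiedModel` accepts an inhabitant of this one by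
`Iff.rfl` once both files sit in one development.) [cite: Katz1978, §5] [cite: SerreLocalFields1979, Ch. II §5–§6] -/
def HasUnramifiedModel (J : ℤ_[p] →+* PadicComplexInt p) (G : PowerSeries (PowerSeries (PadicComplexInt p))) : Prop :=
  ∃ (𝒪 : Type) (_ : CommRing 𝒪) (_ : IsDomain 𝒪) (_ : IsDiscreteValuationRing 𝒪)
    (_ : IsAdicComplete (IsLocalRing.maximalIdeal 𝒪) 𝒪) (_ : CharZero 𝒪) (_ : Algebra ℤ_[p] 𝒪)
    (ι : 𝒪 →+* PadicComplexInt p) (G𝒪 : PowerSeries (PowerSeries 𝒪)),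
    Irreducible (p : 𝒪) ∧ ι.comp (algebraMap ℤ_[p] 𝒪) = J ∧ PowerSeries.map (PowerSeries.map ι) G𝒪 = G

/-- **(G0)(i) (i-b) TYPED — `G` has a `W(𝔽̄_p)`-model along `ι_W`.** For the frame's `G` of 20728 (Katz two-variable measure
`LK` read through `IsGreenbergLFunctionAnyRoot₂`, times the frame's factors) this is the ONE arithmetic input door 5's coefficient
model still owes: Katz's measure is `W(𝔽̄_p)`-valued. A CONSTRUCTION statement about the specific `G`, kept apart from every
interface. [cite: Katz1978, §5.3] [cite: HidaTilouine1993, Thm 1.1] -/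
def HasWittModel (G : PowerSeries (PowerSeries (PadicComplexInt p))) : Prop :=
  ∃ GW : PowerSeries (PowerSeries (WittVector p (ResidueFieldBar p))), PowerSeries.map (PowerSeries.map (iotaW p)) GW = G

variable {p}

/-- **Coefficientwise form of (i-b)**: `G` has a `W(𝔽̄_p)`-model along `ι_W` iff every coefficient of `G` lies in
`ι_W(W(𝔽̄_p)) ⊆ 𝒪_{ℂ_p}` — the form in which «the Katz measure takes values in `W`» is quoted. [cite: Katz1978, §5.3] -/
theorem hasWittModel_iff_forall_coeff_mem_range (G : PowerSeries (PowerSeries (PadicComplexInt p))) :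
    HasWittModel p G ↔ ∀ m n : ℕ, PowerSeries.coeff n (PowerSeries.coeff m G) ∈ Set.range (iotaW p) := by
  constructor
  · rintro ⟨GW, rfl⟩ m n
    exact ⟨PowerSeries.coeff n (PowerSeries.coeff m GW), by simp [PowerSeries.coeff_map]⟩
  · intro h
    choose g hg using h
    refine ⟨PowerSeries.mk fun m => PowerSeries.mk fun n => g m n, ?_⟩
    ext m n
    simp [PowerSeries.coeff_map, PowerSeries.coeff_mk, hg]

/-- `𝔪_{W(k)} = (p)` (Mathlib `WittVector.ker_constantCoeff`; restated from `Door5Supply` §7.5). [folklore] -/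
theorem maximalIdeal_wittVector_eq (k : Type) [Field k] [CharP k p] [PerfectRing k p] :
    IsLocalRing.maximalIdeal (WittVector p k) = Ideal.span {(p : WittVector p k)} := by
  rw [← WittVector.ker_constantCoeff]
  exact (IsLocalRing.eq_maximalIdeal (RingHom.ker_isMaximal_of_surjective _
    (WittVector.constantCoeff_surjective (p := p) (R := k)))).symm

/-- `W(k)` is `𝔪`-adically complete (Mathlib `WittVector.isAdicCompleteIdealSpanP`; restated from `Door5Supply` §7.5).
[folklore] -/
theorem isAdicComplete_wittVector (k : Type) [Field k] [CharP k p] [PerfectRing k p] :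
    IsAdicComplete (IsLocalRing.maximalIdeal (WittVector p k)) (WittVector p k) := by
  rw [maximalIdeal_wittVector_eq]
  exact WittVector.isAdicCompleteIdealSpanP

/-- `W(k)` has characteristic `0` for a field `k` of characteristic `p` (restated from `Door5Supply` §7.5). [folklore] -/
theorem charZero_wittVector (k : Type) [Field k] [CharP k p] : CharZero (WittVector p k) := by
  obtain ⟨q, hq⟩ := CharP.exists (WittVector p k)
  rcases CharP.char_is_prime_or_zero (WittVector p k) q with hqp | hq0
  · exfalso
    have h1 : (q : WittVector p k) = 0 := CharP.cast_eq_zero (WittVector p k) q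
    have h2 : (q : k) = 0 := by
      have := congrArg WittVector.constantCoeff h1
      rwa [map_natCast, map_zero] at this
    rw [CharP.cast_eq_zero_iff k p q] at h2
    have hqp' : q = p := ((Nat.prime_dvd_prime_iff_eq (Fact.out) hqp).mp h2).symm
    subst hqp'
    exact WittVector.p_nonzero q k h1
  · subst hq0
    exact CharP.charP_to_charZero (WittVector p k)

/-- The structure map `ℤ_p → W(k)`: `W(ℤ/p → k) ∘ (WittVector.equiv p)⁻¹` (restated from `Door5Supply` §7.3).
[cite: SerreLocalFields1979, Ch. II §6] -/
def wittStructureMap (k : Type) [CommRing k] [CharP k p] : ℤ_[p] →+* WittVector p k :=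
  (WittVector.map (ZMod.castHom (dvd_refl p) k)).comp (WittVector.equiv p).symm.toRingHom

/-- **Ring homomorphisms `ℤ_p → 𝒪_{ℂ_p}` are unique** (restated with its proof from `Door5Supply` §7.5 (b): `x ≡ x.appr n
mod p^n`, so `J x - J' x ∈ p^n 𝒪_{ℂ_p}` for all `n`, and `𝒪_{ℂ_p}` is `p`-adically separated). [folklore] -/
theorem ringHom_padicInt_ext' (J J' : ℤ_[p] →+* PadicComplexInt p) : J = J' := by
  refine RingHom.ext fun x ↦ ?_
  have hdiv : ∀ n : ℕ, ∃ z : PadicComplexInt p, J x - J' x = (p : PadicComplexInt p) ^ n * z := by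
    intro n
    obtain ⟨y, hy⟩ := Ideal.mem_span_singleton'.mp (PadicInt.appr_spec n x)
    refine ⟨J y - J' y, ?_⟩
    have hx : x = (x.appr n : ℤ_[p]) + (p : ℤ_[p]) ^ n * y := by rw [mul_comm, hy]; ring
    conv_lhs => rw [hx]
    simp only [map_add, map_mul, map_pow, map_natCast]
    ring
  have hv : ∀ n : ℕ, Valued.v ((J x - J' x : PadicComplexInt p) : PadicComplex p) ≤ (1 / (p : ℝ≥0)) ^ n := by
    intro n
    obtain ⟨z, hz⟩ := hdiv n
    have hz1 : Valued.v ((z : PadicComplexInt p) : PadicComplex p) ≤ 1 :=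
      (Valuation.mem_valuationSubring_iff _ _).mp z.2
    rw [hz]
    push_cast
    rw [map_mul, map_pow, PadicComplex.valuation_p]
    exact mul_le_of_le_one_right zero_le hz1
  have hp1 : (1 / (p : ℝ≥0)) < 1 := by
    rw [one_div, inv_lt_one_iff₀]; right
    exact_mod_cast (Fact.out : p.Prime).one_lt
  by_contra hne
  have hne' : ((J x - J' x : PadicComplexInt p) : PadicComplex p) ≠ 0 := by
    intro h0
    apply hne
    have : (J x - J' x : PadicComplexInt p) = 0 := by exact_mod_cast h0
    exact sub_eq_zero.mp this
  have hpos : 0 < Valued.v ((J x - J' x : PadicComplexInt p) : PadicComplex p) :=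
    (Valuation.pos_iff _).mpr hne'
  obtain ⟨n, hn⟩ := NNReal.exists_pow_lt_of_lt_one hpos hp1
  exact absurd (hv n) (not_le.mpr hn)

/-- **The glue (G0)(i) (i-a): `HasWittModel p G → HasUnramifiedModel p J G` for EVERY `J`.** `𝒪 = W(𝔽̄_p)` is a member of
door 5's coefficient class (domain, DVR, `𝔪 = (p)`-adically complete, characteristic `0`, `p` irreducible — Mathlib), `ι = ι_W`
(§3), and the conjunct `ι_W ∘ (ℤ_p → W) = J` is automatic (`ringHom_padicInt_ext'`). What door 5 then still owes on the
coefficient side is exactly (i-b) `HasWittModel p G` for the frame's `G`. [cite: Katz1978, §5.3] [cite: SerreLocalFields1979, Ch. II §5–§6] -/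
theorem hasUnramifiedModel_of_hasWittModel (J : ℤ_[p] →+* PadicComplexInt p)
    (G : PowerSeries (PowerSeries (PadicComplexInt p))) (h : HasWittModel p G) : HasUnramifiedModel p J G := by
  obtain ⟨GW, hG⟩ := h
  letI : Algebra ℤ_[p] (WittVector p (ResidueFieldBar p)) := (wittStructureMap (p := p) (ResidueFieldBar p)).toAlgebra
  haveI := isAdicComplete_wittVector (p := p) (ResidueFieldBar p)
  haveI := charZero_wittVector (p := p) (ResidueFieldBar p)
  exact ⟨WittVector p (ResidueFieldBar p), inferInstance, inferInstance, inferInstance, inferInstance, inferInstance,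
    inferInstance, iotaW p, GW, WittVector.irreducible p, ringHom_padicInt_ext' _ _, hG⟩

end Beta

end Summit.BirchSwinnertonDyer.BirchSwinnertonDyer.Cruxes.TwoVariableEulerSystemDivisibility.Door5SupplyO

end
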